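import Summits.QuantumFields.YangMills.Theorems.ColdStartUniversalityLatticeLangevinRiemannContractionAllLipschitz
import HarnessLib

/-!
# The quaternionic-retraction extension `F̃ = χ·(F∘π)` of G52–G54 with LOCAL Lipschitz data: `ρ_L(Q, π(x)) ≤ 12√#E·‖x − coords Q‖_∞`, and the
# common-shift dilatation bound `|F̃(coords Q' − t) − F̃(coords w − t)| ≤ (G_w/(1−2r) + η)·ρ_L(w,Q')` from a Lipschitz bound on ONE `ρ_L`-ball

Seat `ym-line-csu-p1` (g42), route `ColdStartUniversality` of `Summits/QuantumFields/YangMills`, helper file G63b (`--supports stmt-QuantumFields-24809`).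
G54's `ext_shift_sub_le` / `ext_shift_uniformLocalLipschitz` assume `F` globally Lipschitz.  For the mollification of the Hopf–Lax functions in Kuwada's
duality (sequel files) the Lipschitz constant must be read off locally, ball by ball:

* ★ `riemannDist_retr_le` — the retraction `π` moves a configuration by at most `12√#E·r` in `ρ_L` when the coordinates move by `r ≤ 1/4` in sup norm
  (G53's modulus bound applied to the `1`-Lipschitz observable `ρ_L(Q,·)`);
* ★★ `ext_shift_sub_le_local` — G54's dilatation bound when `F` is `G_w`-Lipschitz on `{ρ_L(w,·) ≤ R}` only, for `ρ_L(w,Q') + 12√#E·r ≤ R`;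
* ★★ `ext_shift_localLipschitz_at` — for `12√#E·r < R` and `η > 0` a radius `δ > 0` with `|F̃(coords Q' − t) − F̃(coords w − t)| ≤ (G_w/(1−2r) + η)·ρ_L(w,Q')`
  for all `‖t‖_∞ ≤ r`, `ρ_L(w,Q') < δ`.

THEOREMS ONLY, no definition, no sorry.  HONEST FRAMING: fixed cut-off, `|β'| < 1/12`; "uniform" = in `L`; nothing `K`-uniform along the route's
scaling; `UniformColdStartMixing` (24809, ASIDE) is not restated; no crux, rung or summit statement is proved; the Yang–Mills mass gap is NOT proved.
-/

set_option autoImplicit false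

noncomputable section

namespace Summit.QuantumFields.YangMills.Theorems.ColdStartUniversality

open MeasureTheory ProbabilityTheory Matrix Complex Finset Filter Topology Set Metric
open scoped ComplexConjugate BigOperators Real NNReal Convolution
open Literature.MathematicalPhysics.QuantumFieldTheory
open Literature.MathematicalPhysics.QuantumLattice (fundamentalRep fundamentalLatticeRep continuous_fundamentalRep fundamentalRep_apply fundamentalLatticeRep_N)

variable {L : ℕ} [NeZero L]

/-! ## §3. The retraction and the common-shift dilatation, locally -/

/-- ★ **The retraction moves `ρ_L` by at most `12√#E·r`**: for `‖x − coords Q‖_∞ ≤ r ≤ 1/4`, `ρ_L(Q, π(x)) ≤ 12·√#E·r` (G53's modulus bound applied to the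
`1`-Lipschitz observable `ρ_L(Q, ·)`). [cite: ShenZhuZhu2022, §4.1] -/
theorem riemannDist_retr_le (Q : GaugeConfig 3 L (Matrix.specialUnitaryGroup (Fin 2) ℂ)) (x : Edge 3 L × Fin 2 × Fin 2 × Bool → ℝ) {r : ℝ} (hr : r ≤ 1 / 4) :
    let coords : GaugeConfig 3 L (Matrix.specialUnitaryGroup (Fin 2) ℂ) → (Edge 3 L × Fin 2 × Fin 2 × Bool → ℝ) :=
      fun V q => (fun z : ℂ => if q.2.2.2 then z.im else z.re) ((fundamentalRep (Fin 2) (V q.1) : Matrix (Fin 2) (Fin 2) ℂ) q.2.1 q.2.2.1)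
    let rebuild : (Edge 3 L × Fin 2 × Fin 2 × Bool → ℝ) → Edge 3 L → Matrix (Fin 2) (Fin 2) ℂ :=
      fun x e => Matrix.of fun i j : Fin 2 => ((x (e, i, j, false) : ℝ) : ℂ) + ((x (e, i, j, true) : ℝ) : ℂ) * Complex.I
    let qP : Matrix (Fin 2) (Fin 2) ℂ → Matrix (Fin 2) (Fin 2) ℂ := fun M =>
      !![(M 0 0 + conj (M 1 1)) / 2, (M 0 1 - conj (M 1 0)) / 2; -conj ((M 0 1 - conj (M 1 0)) / 2), conj ((M 0 0 + conj (M 1 1)) / 2)]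
    let retr : (Edge 3 L × Fin 2 × Fin 2 × Bool → ℝ) → GaugeConfig 3 L (Matrix.specialUnitaryGroup (Fin 2) ℂ) := fun x e =>
      if h : hsForm 2 (qP (rebuild x e)) (qP (rebuild x e)) ≠ 0 then
        ⟨(Real.sqrt 2 / Real.sqrt (hsForm 2 (qP (rebuild x e)) (qP (rebuild x e)))) • qP (rebuild x e),
          normalize_quatProj_mem_specialUnitaryGroup_two (rebuild x e) h⟩
      else 1
    ‖x - coords Q‖ ≤ r → Real.sqrt (torusRiemannDistSq (fundamentalLatticeRep 2) Q (retr x)) ≤ 12 * Real.sqrt (Fintype.card (Edge 3 L)) * r := by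
  intro coords rebuild qP retr hx
  let cut : (Edge 3 L × Fin 2 × Fin 2 × Bool → ℝ) → ℝ := fun x =>
    ∏ e : Edge 3 L, Real.smoothTransition (8 * hsForm 2 (qP (rebuild x e)) (qP (rebuild x e)) - 1)
  have hlip1 : ∀ P P' : GaugeConfig 3 L (Matrix.specialUnitaryGroup (Fin 2) ℂ),
      |Real.sqrt (torusRiemannDistSq (fundamentalLatticeRep 2) Q P') - Real.sqrt (torusRiemannDistSq (fundamentalLatticeRep 2) Q P)| ≤
        1 * Real.sqrt (torusRiemannDistSq (fundamentalLatticeRep 2) P P') := by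
    intro P P'
    rw [one_mul, abs_le]
    constructor
    · have h := sqrt_torusRiemannDistSq_two_triangle Q P' P
      rw [torusRiemannDistSq_two_comm P' P] at h
      linarith
    · linarith [sqrt_torusRiemannDistSq_two_triangle Q P P']
  have hx' : ‖x - coords Q‖ ≤ 1 / 4 := hx.trans hr
  have hcut : cut x = 1 := (retr_near Q x hx').2.1
  have hmod : |cut x * Real.sqrt (torusRiemannDistSq (fundamentalLatticeRep 2) Q (retr x)) - Real.sqrt (torusRiemannDistSq (fundamentalLatticeRep 2) Q Q)| ≤
      1 * (12 * Real.sqrt (Fintype.card (Edge 3 L)) * r) :=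
    ext_modulus (fun P => Real.sqrt (torusRiemannDistSq (fundamentalLatticeRep 2) Q P)) zero_le_one hlip1 Q x hr hx
  rw [hcut, one_mul, one_mul, torusRiemannDistSq_self, Real.sqrt_zero, sub_zero, abs_of_nonneg (Real.sqrt_nonneg _)] at hmod
  exact hmod

/-- ★★ **Common-shift dilatation with a LOCAL Lipschitz hypothesis.**  Let `F` be `G_w`-Lipschitz for `ρ_L` on the ball `{ρ_L(w,·) ≤ R}`.  For
`‖t‖_∞ ≤ r ≤ 1/4`, `u < 1`, `ρ_L(w,Q') + 12√#E·r ≤ R` and `(1/(1−2r))²·ρ_L(w,Q')² ≤ 8u`: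
`|F̃(coords Q' − t) − F̃(coords w − t)| ≤ G_w·((1/(1−2r))/√(1−u))·ρ_L(w,Q')` (both retracted points lie in the ball, G53/G54). [cite: ShenZhuZhu2022, §4.1] -/
theorem ext_shift_sub_le_local (F : GaugeConfig 3 L (Matrix.specialUnitaryGroup (Fin 2) ℂ) → ℝ)
    (w : GaugeConfig 3 L (Matrix.specialUnitaryGroup (Fin 2) ℂ)) {R Gw : ℝ} (hGw : 0 ≤ Gw)
    (hlipR : ∀ z' z'' : GaugeConfig 3 L (Matrix.specialUnitaryGroup (Fin 2) ℂ),
      Real.sqrt (torusRiemannDistSq (fundamentalLatticeRep 2) w z') ≤ R → Real.sqrt (torusRiemannDistSq (fundamentalLatticeRep 2) w z'') ≤ R →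
        |F z'' - F z'| ≤ Gw * Real.sqrt (torusRiemannDistSq (fundamentalLatticeRep 2) z' z''))
    (Q' : GaugeConfig 3 L (Matrix.specialUnitaryGroup (Fin 2) ℂ)) (t : Edge 3 L × Fin 2 × Fin 2 × Bool → ℝ) {r u : ℝ} (hr : r ≤ 1 / 4) (hu : u < 1) :
    let coords : GaugeConfig 3 L (Matrix.specialUnitaryGroup (Fin 2) ℂ) → (Edge 3 L × Fin 2 × Fin 2 × Bool → ℝ) :=
      fun V q => (fun z : ℂ => if q.2.2.2 then z.im else z.re) ((fundamentalRep (Fin 2) (V q.1) : Matrix (Fin 2) (Fin 2) ℂ) q.2.1 q.2.2.1)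
    let rebuild : (Edge 3 L × Fin 2 × Fin 2 × Bool → ℝ) → Edge 3 L → Matrix (Fin 2) (Fin 2) ℂ :=
      fun x e => Matrix.of fun i j : Fin 2 => ((x (e, i, j, false) : ℝ) : ℂ) + ((x (e, i, j, true) : ℝ) : ℂ) * Complex.I
    let qP : Matrix (Fin 2) (Fin 2) ℂ → Matrix (Fin 2) (Fin 2) ℂ := fun M =>
      !![(M 0 0 + conj (M 1 1)) / 2, (M 0 1 - conj (M 1 0)) / 2; -conj ((M 0 1 - conj (M 1 0)) / 2), conj ((M 0 0 + conj (M 1 1)) / 2)]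
    let retr : (Edge 3 L × Fin 2 × Fin 2 × Bool → ℝ) → GaugeConfig 3 L (Matrix.specialUnitaryGroup (Fin 2) ℂ) := fun x e =>
      if h : hsForm 2 (qP (rebuild x e)) (qP (rebuild x e)) ≠ 0 then
        ⟨(Real.sqrt 2 / Real.sqrt (hsForm 2 (qP (rebuild x e)) (qP (rebuild x e)))) • qP (rebuild x e),
          normalize_quatProj_mem_specialUnitaryGroup_two (rebuild x e) h⟩
      else 1
    let cut : (Edge 3 L × Fin 2 × Fin 2 × Bool → ℝ) → ℝ := fun x =>
      ∏ e : Edge 3 L, Real.smoothTransition (8 * hsForm 2 (qP (rebuild x e)) (qP (rebuild x e)) - 1)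
    ‖t‖ ≤ r → Real.sqrt (torusRiemannDistSq (fundamentalLatticeRep 2) w Q') + 12 * Real.sqrt (Fintype.card (Edge 3 L)) * r ≤ R →
      (1 / (1 - 2 * r)) ^ 2 * torusRiemannDistSq (fundamentalLatticeRep 2) w Q' ≤ 8 * u →
      |cut (coords Q' - t) * F (retr (coords Q' - t)) - cut (coords w - t) * F (retr (coords w - t))| ≤
        Gw * ((1 / (1 - 2 * r)) / Real.sqrt (1 - u)) * Real.sqrt (torusRiemannDistSq (fundamentalLatticeRep 2) w Q') := by
  intro coords rebuild qP retr cut ht hR hsmall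
  have hr0 : 0 ≤ r := le_trans (norm_nonneg _) ht
  have hx : ‖coords w - t - coords w‖ ≤ r := by rw [sub_sub_cancel_left, norm_neg]; exact ht
  have hx' : ‖coords Q' - t - coords Q'‖ ≤ r := by rw [sub_sub_cancel_left, norm_neg]; exact ht
  have hcut : cut (coords w - t) = 1 := (retr_near w (coords w - t) (hx.trans hr)).2.1
  have hcut' : cut (coords Q' - t) = 1 := (retr_near Q' (coords Q' - t) (hx'.trans hr)).2.1
  -- both retracted points are in the ball
  have hE0 : 0 ≤ 12 * Real.sqrt (Fintype.card (Edge 3 L)) * r := by positivity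
  have hin : Real.sqrt (torusRiemannDistSq (fundamentalLatticeRep 2) w (retr (coords w - t))) ≤ R := by
    have h1 : Real.sqrt (torusRiemannDistSq (fundamentalLatticeRep 2) w (retr (coords w - t))) ≤ 12 * Real.sqrt (Fintype.card (Edge 3 L)) * r :=
      riemannDist_retr_le w (coords w - t) hr hx
    linarith [Real.sqrt_nonneg (torusRiemannDistSq (fundamentalLatticeRep 2) w Q')]
  have hin' : Real.sqrt (torusRiemannDistSq (fundamentalLatticeRep 2) w (retr (coords Q' - t))) ≤ R := by
    have h1 : Real.sqrt (torusRiemannDistSq (fundamentalLatticeRep 2) Q' (retr (coords Q' - t))) ≤ 12 * Real.sqrt (Fintype.card (Edge 3 L)) * r :=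
      riemannDist_retr_le Q' (coords Q' - t) hr hx'
    have h2 := sqrt_torusRiemannDistSq_two_triangle w Q' (retr (coords Q' - t))
    linarith
  have hT : torusRiemannDistSq (fundamentalLatticeRep 2) (retr (coords w - t)) (retr (coords Q' - t)) ≤
      (1 / (1 - 2 * r)) ^ 2 / (1 - u) * torusRiemannDistSq (fundamentalLatticeRep 2) w Q' :=
    torusRiemannDistSq_retr_shift_le w Q' t hr hu ht hsmall
  have h1u : 0 ≤ 1 - u := by linarith
  have hlam : 0 ≤ 1 / (1 - 2 * r) := div_nonneg zero_le_one (by linarith)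
  rw [hcut, hcut', one_mul, one_mul]
  calc |F (retr (coords Q' - t)) - F (retr (coords w - t))|
      ≤ Gw * Real.sqrt (torusRiemannDistSq (fundamentalLatticeRep 2) (retr (coords w - t)) (retr (coords Q' - t))) := hlipR _ _ hin hin'
    _ ≤ Gw * Real.sqrt ((1 / (1 - 2 * r)) ^ 2 / (1 - u) * torusRiemannDistSq (fundamentalLatticeRep 2) w Q') :=
        mul_le_mul_of_nonneg_left (Real.sqrt_le_sqrt hT) hGw
    _ = Gw * ((1 / (1 - 2 * r)) / Real.sqrt (1 - u)) * Real.sqrt (torusRiemannDistSq (fundamentalLatticeRep 2) w Q') := by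
        rw [Real.sqrt_mul (div_nonneg (sq_nonneg _) h1u), Real.sqrt_div (sq_nonneg _), Real.sqrt_sq hlam]; ring

/-- ★★ **Local Lipschitz bound at a point along common shifts.**  Under the hypotheses of `ext_shift_sub_le_local` with `12√#E·r < R`: for every `η > 0`
there is `δ > 0` such that `|F̃(coords Q' − t) − F̃(coords w − t)| ≤ (G_w/(1−2r) + η)·ρ_L(w,Q')` for all `‖t‖_∞ ≤ r` and `ρ_L(w,Q') < δ`.
[cite: ShenZhuZhu2022, §4.1] -/
theorem ext_shift_localLipschitz_at (F : GaugeConfig 3 L (Matrix.specialUnitaryGroup (Fin 2) ℂ) → ℝ)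
    (w : GaugeConfig 3 L (Matrix.specialUnitaryGroup (Fin 2) ℂ)) {R Gw : ℝ} (hGw : 0 ≤ Gw)
    (hlipR : ∀ z' z'' : GaugeConfig 3 L (Matrix.specialUnitaryGroup (Fin 2) ℂ),
      Real.sqrt (torusRiemannDistSq (fundamentalLatticeRep 2) w z') ≤ R → Real.sqrt (torusRiemannDistSq (fundamentalLatticeRep 2) w z'') ≤ R →
        |F z'' - F z'| ≤ Gw * Real.sqrt (torusRiemannDistSq (fundamentalLatticeRep 2) z' z''))
    {r : ℝ} (hr : r ≤ 1 / 4) (hrR : 12 * Real.sqrt (Fintype.card (Edge 3 L)) * r < R) {η : ℝ} (hη : 0 < η) :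
    let coords : GaugeConfig 3 L (Matrix.specialUnitaryGroup (Fin 2) ℂ) → (Edge 3 L × Fin 2 × Fin 2 × Bool → ℝ) :=
      fun V q => (fun z : ℂ => if q.2.2.2 then z.im else z.re) ((fundamentalRep (Fin 2) (V q.1) : Matrix (Fin 2) (Fin 2) ℂ) q.2.1 q.2.2.1)
    let rebuild : (Edge 3 L × Fin 2 × Fin 2 × Bool → ℝ) → Edge 3 L → Matrix (Fin 2) (Fin 2) ℂ :=
      fun x e => Matrix.of fun i j : Fin 2 => ((x (e, i, j, false) : ℝ) : ℂ) + ((x (e, i, j, true) : ℝ) : ℂ) * Complex.I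
    let qP : Matrix (Fin 2) (Fin 2) ℂ → Matrix (Fin 2) (Fin 2) ℂ := fun M =>
      !![(M 0 0 + conj (M 1 1)) / 2, (M 0 1 - conj (M 1 0)) / 2; -conj ((M 0 1 - conj (M 1 0)) / 2), conj ((M 0 0 + conj (M 1 1)) / 2)]
    let retr : (Edge 3 L × Fin 2 × Fin 2 × Bool → ℝ) → GaugeConfig 3 L (Matrix.specialUnitaryGroup (Fin 2) ℂ) := fun x e =>
      if h : hsForm 2 (qP (rebuild x e)) (qP (rebuild x e)) ≠ 0 then
        ⟨(Real.sqrt 2 / Real.sqrt (hsForm 2 (qP (rebuild x e)) (qP (rebuild x e)))) • qP (rebuild x e),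
          normalize_quatProj_mem_specialUnitaryGroup_two (rebuild x e) h⟩
      else 1
    let cut : (Edge 3 L × Fin 2 × Fin 2 × Bool → ℝ) → ℝ := fun x =>
      ∏ e : Edge 3 L, Real.smoothTransition (8 * hsForm 2 (qP (rebuild x e)) (qP (rebuild x e)) - 1)
    ∃ δ > 0, ∀ t : Edge 3 L × Fin 2 × Fin 2 × Bool → ℝ, ‖t‖ ≤ r → ∀ Q' : GaugeConfig 3 L (Matrix.specialUnitaryGroup (Fin 2) ℂ),
      Real.sqrt (torusRiemannDistSq (fundamentalLatticeRep 2) w Q') < δ →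
        |cut (coords Q' - t) * F (retr (coords Q' - t)) - cut (coords w - t) * F (retr (coords w - t))| ≤
          (Gw / (1 - 2 * r) + η) * Real.sqrt (torusRiemannDistSq (fundamentalLatticeRep 2) w Q') := by
  intro coords rebuild qP retr cut
  set lam : ℝ := 1 / (1 - 2 * r) with hlamdef
  have h12 : 0 < 1 - 2 * r := by linarith
  have hlam : 0 < lam := div_pos one_pos h12
  set C : ℝ := Gw / (1 - 2 * r) with hCdef
  have hC : C = Gw * lam := div_eq_mul_one_div _ _
  have hC0 : 0 ≤ C := div_nonneg hGw h12.le
  set u : ℝ := min (1 / 2) (η / (C + 1)) with hudef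
  have hu0 : 0 < u := lt_min (by norm_num) (div_pos hη (by linarith))
  have hu2 : u ≤ 1 / 2 := min_le_left _ _
  have huη : u ≤ η / (C + 1) := min_le_right _ _
  have hu1 : u < 1 := by linarith
  -- `δ = min(√(8u)/λ, R − 12√#E·r)`
  set gap : ℝ := R - 12 * Real.sqrt (Fintype.card (Edge 3 L)) * r with hgap
  have hgap0 : 0 < gap := by rw [hgap]; linarith
  refine ⟨min (Real.sqrt (8 * u) / lam) gap, lt_min (div_pos (Real.sqrt_pos.2 (by linarith)) hlam) hgap0, fun t ht Q' hQ => ?_⟩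
  have hQ1 : Real.sqrt (torusRiemannDistSq (fundamentalLatticeRep 2) w Q') < Real.sqrt (8 * u) / lam := lt_of_lt_of_le hQ (min_le_left _ _)
  have hQ2 : Real.sqrt (torusRiemannDistSq (fundamentalLatticeRep 2) w Q') < gap := lt_of_lt_of_le hQ (min_le_right _ _)
  set D : ℝ := Real.sqrt (torusRiemannDistSq (fundamentalLatticeRep 2) w Q') with hDdef
  have hD0 : 0 ≤ D := Real.sqrt_nonneg _
  have hDsq : D ^ 2 = torusRiemannDistSq (fundamentalLatticeRep 2) w Q' :=
    Real.sq_sqrt (by unfold torusRiemannDistSq; exact Finset.sum_nonneg fun _ _ => sq_nonneg _)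
  have hsmall : (1 / (1 - 2 * r)) ^ 2 * torusRiemannDistSq (fundamentalLatticeRep 2) w Q' ≤ 8 * u := by
    have h1 : lam * D < Real.sqrt (8 * u) := by rw [mul_comm]; exact (lt_div_iff₀ hlam).1 hQ1
    have h2 : (lam * D) ^ 2 < Real.sqrt (8 * u) ^ 2 := pow_lt_pow_left₀ h1 (mul_nonneg hlam.le hD0) two_ne_zero
    rw [Real.sq_sqrt (by linarith), mul_pow, hDsq] at h2
    exact h2.le
  have hRle : D + 12 * Real.sqrt (Fintype.card (Edge 3 L)) * r ≤ R := by rw [hgap] at hQ2; linarith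
  have hmain : |cut (coords Q' - t) * F (retr (coords Q' - t)) - cut (coords w - t) * F (retr (coords w - t))| ≤
      Gw * (lam / Real.sqrt (1 - u)) * D := ext_shift_sub_le_local F w hGw hlipR Q' t hr hu1 ht hRle hsmall
  refine hmain.trans (mul_le_mul_of_nonneg_right ?_ hD0)
  have h1u : 0 < 1 - u := by linarith
  have hK : 1 / Real.sqrt (1 - u) ≤ 1 + u := by
    rw [div_le_iff₀ (Real.sqrt_pos.2 h1u)]
    have hsq : (1 + u) * Real.sqrt (1 - u) = Real.sqrt ((1 + u) ^ 2 * (1 - u)) := by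
      rw [Real.sqrt_mul (sq_nonneg _), Real.sqrt_sq (by linarith)]
    rw [hsq]
    refine Real.one_le_sqrt.2 ?_
    have hpoly : 0 ≤ u * (1 - u - u ^ 2) := mul_nonneg hu0.le (by nlinarith)
    nlinarith
  have hCu : C * u ≤ η := by
    have h1 : C * u ≤ (C + 1) * u := by nlinarith
    have h2 : (C + 1) * u ≤ η := by
      have := (le_div_iff₀ (by linarith : (0 : ℝ) < C + 1)).1 huη
      linarith
    linarith
  calc Gw * (lam / Real.sqrt (1 - u)) = C * (1 / Real.sqrt (1 - u)) := by rw [hC]; ring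
    _ ≤ C * (1 + u) := mul_le_mul_of_nonneg_left hK hC0
    _ = C + C * u := by ring
    _ ≤ C + η := by linarith

end Summit.QuantumFields.YangMills.Theorems.ColdStartUniversality

end
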